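import Literature.NumberTheory.EllipticCurves.Phi64
import Literature.NumberTheory.EllipticCurves.CongruentNewformThetaProofs
import HarnessLib

/-!
# The `q`-expansion of `φ₆₄ = ½ Θ′ θ₄`: `a_N(φ₆₄) = (2/N) Re S(N) = a_N(E₂)`

[[cite: Tunnell1983Congruent, p. 325]] [[cite: KoblitzECMF1993, Ch. IV §4]] — the weight-`2`
cusp form `φ₆₄ = ½ Θ′ θ₄ ∈ S₂(Γ₀(64))` (`Phi64`) is the newform of the congruent number curve
`E₂ : 2y² = x³ - x` (64a): its `q`-expansion coefficients are the `L`-series coefficients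
`a_N(E₂) = (2/N) Re S(N)`, `S(N) = ∑_{x primary, N x = N} x`.  We PROVE this by reduction to the
sibling file `CongruentNewformThetaProofs` (the level-`32` form `φ = ½ θ₁'(8z) θ₄(8z)` with
`a_N(φ) = Re S(N)` and `a_N(E_n) = (n/N) a_N(φ)`):

* `thetaChi_eq_theta1'_eight` — **`Θ′(z) = θ₁'(8z)`** (`= 2η(8z)³`; reindexing `m = 2n + 1`,
  `χ₋₄(2n+1) = (-1)ⁿ`), the bridge asked for in the review of `ThetaChiFour`;
* `phi64_eq_half_theta1'_mul_theta3` — `φ₆₄ = ½ θ₁'(8z) θ₃(8z)`;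
* `hasSum_phi64_pairs`, `hasSum_phi64` — the double series `½ ∑ (-1)ⁿ(2n+1) q^{(2n+1)²+4b²}`
  regrouped by the exponent; on its support `(-1)ᵇ = (2/N)` (`neg_one_pow_eq_jacobiSym_two`), so
  the coefficient is `(2/N) · Re S(N)` by the tree's `pairSum_eq_two_mul_re_primarySum`;
* `qCoeffs_phi64 : a_N(φ₆₄) = (2/N) Re S(N)`, `qCoeffs_phi64_eq_jacobiSym_mul_congruentPhi :
  a_N(φ₆₄) = (2/N) a_N(φ)`, and **`qCoeffs_phi64_eq_lFunction : a_N(φ₆₄) = a_N(E₂)`** (`N ≥ 1`).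

No named facts, no definitions.
-/

noncomputable section

open scoped MatrixGroups NumberTheorySymbols

open UpperHalfPlane hiding I
open Complex Filter Topology
open Function (Periodic)

namespace Literature.NumberTheory.EllipticCurves.ModularForms

open Literature.NumberTheory.EllipticCurves.Tunnell1983
open Literature.NumberTheory.EllipticCurves.JacobiThetaNull
open Literature.NumberTheory.QuadraticFields.GaussianPrimary

variable (z : ℍ)

/-! ### The bridge `Θ′(z) = θ₁'(8z)` -/

/-- `χ₋₄(2n+1) = (-1)^{|n|}`. [folklore] -/
theorem chiM4_two_mul_add_one (n : ℤ) : chiM4 (2 * n + 1) = (-1 : ℂ) ^ n.natAbs := by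
  unfold chiM4
  rcases Int.even_or_odd n with hn | hn
  · rw [(Int.natAbs_even.mpr hn).neg_one_pow]
    obtain ⟨k, rfl⟩ := hn
    rw [show (2 * (k + k) + 1 : ℤ) = 1 + 4 * k by ring, Int.cast_add, Int.cast_mul,
      show ((4 : ℤ) : ZMod 4) = 0 from rfl, zero_mul, add_zero, Int.cast_one,
      show ZMod.χ₄ 1 = 1 from rfl]
    push_cast
    ring
  · rw [(Int.natAbs_odd.mpr hn).neg_one_pow]
    obtain ⟨k, rfl⟩ := hn
    rw [show (2 * (2 * k + 1) + 1 : ℤ) = 3 + 4 * k by ring, Int.cast_add, Int.cast_mul,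
      show ((4 : ℤ) : ZMod 4) = 0 from rfl, zero_mul, add_zero,
      show ((3 : ℤ) : ZMod 4) = 3 from rfl, show ZMod.χ₄ 3 = -1 from rfl]
    push_cast
    ring

/-- The odd-indexed terms of `Θ′` are the terms of `θ₁'(8z)`. [folklore] -/
theorem thetaChiTerm_two_mul_add_one (n : ℤ) : thetaChiTerm z (2 * n + 1) = termD z n := by
  rw [thetaChiTerm, termD, chiM4_two_mul_add_one, ← one_mul ((2 * n + 1) ^ 2),
    ← Nat.cast_one (R := ℤ), ← thetaTerm_eq_qParam_pow, thetaTerm]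
  push_cast
  ring_nf

/-- The even-indexed terms of `Θ′` vanish. [folklore] -/
theorem thetaChiTerm_two_mul (n : ℤ) : thetaChiTerm z (2 * n) = 0 := by
  rw [thetaChiTerm, chiM4_eq_zero_of_even (even_two_mul n), zero_mul, zero_mul]

/-- **`Θ′(z) = θ₁'(8z)`** (`= 2η(8z)³ = ∑ χ₋₄(m) m q^{m²}`). [folklore] -/
theorem thetaChi_eq_theta1'_eight : thetaChi z = theta1' (8 * (z : ℂ)) := by
  have ho : HasSum (fun n : ℤ ↦ thetaChiTerm z (2 * n + 1)) (theta1' (8 * (z : ℂ))) :=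
    (hasSum_theta1'_eight z).congr_fun fun n ↦ thetaChiTerm_two_mul_add_one z n
  have he : HasSum (fun n : ℤ ↦ thetaChiTerm z (2 * n)) 0 := by
    simp_rw [thetaChiTerm_two_mul]; exact hasSum_zero
  have h := hasSum_int_even_add_odd he ho
  rw [zero_add] at h
  exact (hasSum_thetaChi z).unique h

/-- `φ₆₄ = ½ θ₁'(8z) θ₃(8z)`. [folklore] -/
theorem phi64_eq_half_theta1'_mul_theta3 :
    phi64 z = (1 / 2 : ℂ) * theta1' (8 * (z : ℂ)) * theta3 (8 * (z : ℂ)) := by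
  rw [phi64, thetaChi_eq_theta1'_eight, theta3_eight_eq_thetaMul_four]; ring

/-! ### The double series and the `q`-expansion -/

/-- The double series of `φ₆₄`: `φ₆₄(z) = ½ ∑_{(n,b)} (-1)^{n} (2n+1) q^{(2n+1)² + 4b²}`. [folklore] -/
theorem hasSum_phi64_pairs :
    HasSum (fun x : ℤ × ℤ ↦ ((1 / 2 : ℂ) * ((-1 : ℂ) ^ x.1.natAbs * (2 * x.1 + 1))) *
        Periodic.qParam 1 z ^ ((2 * x.1 + 1) ^ 2 + 4 * x.2 ^ 2).toNat) (phi64 z) := by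
  have h := ((hasSum_theta1'_eight z).mul (hasSum_theta3_eight z)
    (summable_mul_of_summable_norm (summable_norm_termD z) (summable_norm_termB z))).mul_left (1 / 2 : ℂ)
  rw [phi64_eq_half_theta1'_mul_theta3, mul_assoc]
  refine h.congr_fun fun x ↦ ?_
  simp only [termD, termB]
  rw [Int.toNat_add (sq_nonneg _) (by positivity), pow_add]
  ring

/-- On the solutions of `(2n+1)² + 4b² = N`: `(-1)^{b} = (2/N)`. [folklore] -/
theorem neg_one_pow_eq_jacobiSym_two {N : ℕ} {q : ℤ × ℤ} (hq : (2 * q.1 + 1) ^ 2 + 4 * q.2 ^ 2 = (N : ℤ)) :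
    ((-1 : ℤ) ^ q.2.natAbs) = jacobiSym 2 N := by
  have hNodd : Odd N := by
    have : (N : ℤ) % 2 = 1 := by
      rw [← hq]
      have h1 : (2 * q.1 + 1) ^ 2 = 4 * (q.1 ^ 2 + q.1) + 1 := by ring
      omega
    exact Nat.odd_iff.mpr (by exact_mod_cast this)
  rw [jacobiSym.at_two hNodd, ZMod.χ₈_nat_eq_if_mod_eight]
  have hN2 : N % 2 ≠ 0 := by rw [Nat.odd_iff.mp hNodd]; norm_num
  rw [if_neg hN2]
  -- `N mod 8` from the parity of `b`
  have hsq : (2 * q.1 + 1) ^ 2 % 8 = 1 := by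
    have h1 : (2 * q.1 + 1) ^ 2 = 4 * (q.1 * (q.1 + 1)) + 1 := by ring
    have h2 : 2 ∣ q.1 * (q.1 + 1) := by
      rcases Int.even_or_odd q.1 with ⟨k, hk⟩ | ⟨k, hk⟩
      · exact ⟨k * (q.1 + 1), by rw [hk]; ring⟩
      · exact ⟨q.1 * (k + 1), by rw [hk]; ring⟩
    obtain ⟨t, ht⟩ := h2
    rw [h1, ht]; omega
  rcases Int.even_or_odd q.2 with heven | hodd
  · -- `b` even: `N ≡ 1 (mod 8)`
    obtain ⟨k, hk⟩ := heven
    have hb : 4 * q.2 ^ 2 % 8 = 0 := by rw [hk, show 4 * (k + k) ^ 2 = 8 * (2 * k ^ 2) by ring]; simp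
    have hN8 : (N : ℤ) % 8 = 1 := by rw [← hq]; omega
    have hN8' : N % 8 = 1 := by exact_mod_cast hN8
    rw [if_pos (Or.inl hN8'), (Int.natAbs_even.mpr ⟨k, hk⟩).neg_one_pow]
  · -- `b` odd: `N ≡ 5 (mod 8)`
    obtain ⟨k, hk⟩ := hodd
    have hb : 4 * q.2 ^ 2 % 8 = 4 := by
      rw [hk, show 4 * (2 * k + 1) ^ 2 = 8 * (2 * k ^ 2 + 2 * k) + 4 by ring]; omega
    have hN8 : (N : ℤ) % 8 = 5 := by rw [← hq]; omega
    have hN8' : N % 8 = 5 := by exact_mod_cast hN8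
    rw [if_neg (by omega), (Int.natAbs_odd.mpr ⟨k, hk⟩).neg_one_pow]

/-- **The signed pair sum without the `b`-sign**: `∑_{(2n+1)²+4b²=N} (-1)ⁿ (2n+1) = (2/N) · 2 Re S(N)`. [folklore] -/
theorem pairSum_eq_jacobiSym_mul (N : ℕ) :
    ∑ q ∈ pairSet N, (-1 : ℤ) ^ q.1.natAbs * (2 * q.1 + 1) = jacobiSym 2 N * (2 * (primarySum N).re) := by
  rw [← pairSum_eq_two_mul_re_primarySum, Finset.mul_sum]
  refine Finset.sum_congr rfl fun q hq ↦ ?_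
  rw [← neg_one_pow_eq_jacobiSym_two (mem_pairSet.mp hq)]
  have h2 : ((-1 : ℤ) ^ q.2.natAbs) * ((-1 : ℤ) ^ q.2.natAbs) = 1 := by
    rw [← pow_add, ← two_mul, pow_mul, neg_one_sq, one_pow]
  calc (-1 : ℤ) ^ q.1.natAbs * (2 * q.1 + 1)
      = ((-1 : ℤ) ^ q.2.natAbs * (-1 : ℤ) ^ q.2.natAbs) * ((-1 : ℤ) ^ q.1.natAbs * (2 * q.1 + 1)) := by
        rw [h2, one_mul]
    _ = (-1 : ℤ) ^ q.2.natAbs * ((-1 : ℤ) ^ q.1.natAbs * (-1) ^ q.2.natAbs * (2 * q.1 + 1)) := by ring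

/-- **The `q`-expansion of `φ₆₄`**: `φ₆₄ = ∑_N (2/N) Re S(N) q^N`. [cite: Tunnell1983Congruent, p. 325] -/
theorem hasSum_phi64 :
    HasSum (fun N : ℕ ↦ ((jacobiSym 2 N : ℤ) : ℂ) * ((primarySum N).re : ℂ) * Periodic.qParam 1 z ^ N)
      (phi64 z) := by
  classical
  have h := hasSum_nat_of_hasSum_int2 z
    (a := fun x : ℤ × ℤ ↦ (1 / 2 : ℂ) * ((-1 : ℂ) ^ x.1.natAbs * (2 * x.1 + 1)))
    (E := fun x ↦ (2 * x.1 + 1) ^ 2 + 4 * x.2 ^ 2) (fun x ↦ by positivity)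
    (fun x N hx ↦ (Finset.mem_filter.mp (mem_pairSet.mpr hx)).1) (hasSum_phi64_pairs z)
  refine h.congr_fun fun N ↦ ?_
  congr 1
  have hpair := congrArg (fun t : ℤ ↦ (t : ℂ)) (pairSum_eq_jacobiSym_mul N)
  simp only [pairSet, Finset.sum_filter] at hpair
  push_cast at hpair
  have : (∑ x ∈ box2 N, if (2 * x.1 + 1) ^ 2 + 4 * x.2 ^ 2 = (N : ℤ) then
      (1 / 2 : ℂ) * ((-1 : ℂ) ^ x.1.natAbs * (2 * x.1 + 1)) else 0) =
      (1 / 2 : ℂ) * ∑ x ∈ box2 N, (if (2 * x.1 + 1) ^ 2 + 4 * x.2 ^ 2 = (N : ℤ) then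
        ((-1 : ℂ) ^ x.1.natAbs * (2 * x.1 + 1)) else 0) := by
    rw [Finset.mul_sum]
    refine Finset.sum_congr rfl fun x _ ↦ ?_
    split_ifs <;> ring
  rw [this, show box2 N = Finset.Icc (-(N : ℤ)) N ×ˢ Finset.Icc (-(N : ℤ)) N from rfl, hpair]
  ring

/-- **`a_N(φ₆₄) = (2/N) Re S(N)`.** [cite: Tunnell1983Congruent, p. 325] -/
theorem qCoeffs_phi64 :
    qCoeffs phi64 = fun N ↦ ((jacobiSym 2 N : ℤ) : ℂ) * ((primarySum N).re : ℂ) :=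
  qCoeffs_eq_of_hasSum fun z ↦ hasSum_phi64 z

/-- `a_N(φ₆₄) = (2/N) a_N(φ)` (`φ` the level-`32` newform `congruentPhi`). [folklore] -/
theorem qCoeffs_phi64_eq_jacobiSym_mul_congruentPhi (N : ℕ) :
    qCoeffs phi64 N = ((jacobiSym 2 N : ℤ) : ℂ) * qCoeffs congruentPhi N := by
  rw [qCoeffs_phi64, qCoeffs_congruentPhi]

/-- **`a_N(φ₆₄) = a_N(E₂)` for `N ≥ 1`**, `E₂ = congruentNumberCurve 2 : 2y² = x³ - x` (64a): the
`q`-expansion of `φ₆₄` is the `L`-series of the congruent number curve for `n = 2`.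
[cite: KoblitzECMF1993, Ch. IV §4] -/
theorem qCoeffs_phi64_eq_lFunction {N : ℕ} (hN : N ≠ 0) :
    qCoeffs phi64 N = ((congruentNumberCurve 2).LFunction N : ℂ) := by
  rw [qCoeffs_phi64_eq_jacobiSym_mul_congruentPhi,
    lFunction_congruentNumberCurve_eq_jacobiSym_mul_qCoeffs Nat.squarefree_two hN]
  push_cast
  ring

end Literature.NumberTheory.EllipticCurves.ModularForms
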